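import Summits.CriticalPhenomena.PercolationContinuityZ3.Theorems.Transplant.GrigorchukLamplighterStandardGensNoSkeleton
import Summits.CriticalPhenomena.PercolationContinuityZ3.Theorems.Transplant.GrigorchukLevelTransitive
import HarnessLib

/-!
# SIGN-PATTERN AUTOMORPHISMS of `Cay(ℤ ≀_X 𝔊; a, b, c, d, s)`: for every set of lamp positions `P`, negating the lamps in `P` is a graph automorphism fixing
# the identity — caveat (α) is REAL: the vertex stabiliser in `Aut(Cay)` is INFINITE (the discrete-wall theorems «AutDiscreteWall*» do not apply)

builds on p205010 (kernel theorem, internal audit signed; external expert review pending) — nothing in this file uses p205010; graph theory of ONE Cayley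
graph, no percolation statement, nothing about any `@[conjecture]`.  Lane `prim-bschramm`, seat `prim-bschramm-p3` gen 36 (DESIGN OWNER; `P3-NILPOTENT.md`
§29.0/29.2, refuter-confirmed #7786 (1), lead g25 #7833).  Helper file (`--supports stmt-CriticalPhenomena-4575 --as helper`).

CONTENT.  `flipConf P f := f − 2 • f.filter P` (the configuration `f` with the lamps in `P` negated; pointwise `if P r then −f r else f r`);
`Grigorchuk.flipW P : ↥wreathZ → ↥wreathZ` (negate the lamps in `P`, keep the tree coordinate — it stays inside `Γ₂` because the lamp subgroup is generated by the
positions, `frameW.gen`); **`Grigorchuk.flipAut P : Cay ≃g Cay`** (tree edges go to tree edges with the same letter, the `s`-edge at position `g·ρ` to an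
`s^{∓1}`-edge according to `P (g·ρ)`); `flipAut_one` (it fixes the vertex `1`), and **`infinite_stabilizer_one : {α : Cay ≃g Cay | α 1 = 1}.Infinite`** (the
patterns `P = {g·ρ}` for the infinitely many orbit points are pairwise distinct automorphisms) and **`not_countable_stabilizer_one`** (UNCOUNTABLE: the patterns on the
subsets of an infinite orbit sequence inject `Set ℕ`; Cantor).  Together with label rigidity («…LabelRigidity») and the transport
structure («AutChartOrbitsOneLampAutTransport») this types both directions of 'Aut(Cay) = Γ₂ extended by the position-wise lamp reflections' (`P3-NILPOTENT` §29.2).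
[cite: BartholdiErschler2012, §2–§3.1] [cite: BenjaminiSchramm1996, §2 (Cayley graphs)]
-/

noncomputable section

namespace Summit.CriticalPhenomena.PercolationContinuityZ3.Theorems.Transplant

namespace Grigorchuk

open SimpleGraph SemidirectProduct
open scoped Classical

/-! ### §1 Negating the lamps in a set of positions -/

/-- The configuration `f` with the lamps in `P` negated. [folklore] -/
def flipConf (P : Ray → Prop) (f : Ray →₀ ℤ) : Ray →₀ ℤ := f - 2 • f.filter P

/-- Pointwise: `flipConf P f r = if P r then -f r else f r`. [folklore] -/
theorem flipConf_apply (P : Ray → Prop) (f : Ray →₀ ℤ) (r : Ray) : flipConf P f r = if P r then -f r else f r := by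
  unfold flipConf
  rw [Finsupp.sub_apply, Finsupp.smul_apply, Finsupp.filter_apply]
  split_ifs <;> ring

/-- Negating twice is the identity. [folklore] -/
theorem flipConf_flipConf (P : Ray → Prop) (f : Ray →₀ ℤ) : flipConf P (flipConf P f) = f := by
  ext r; rw [flipConf_apply, flipConf_apply]; split_ifs <;> ring

/-- `flipConf P` is additive. [folklore] -/
theorem flipConf_add (P : Ray → Prop) (f f' : Ray →₀ ℤ) : flipConf P (f + f') = flipConf P f + flipConf P f' := by
  ext r; simp only [flipConf_apply, Finsupp.add_apply]; split_ifs <;> ring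

/-- `flipConf P 0 = 0`. [folklore] -/
theorem flipConf_zero (P : Ray → Prop) : flipConf P 0 = 0 := by
  ext r; rw [flipConf_apply]; split_ifs <;> simp

/-- `flipConf P (-f) = -flipConf P f`. [folklore] -/
theorem flipConf_neg (P : Ray → Prop) (f : Ray →₀ ℤ) : flipConf P (-f) = -flipConf P f := by
  ext r; simp only [flipConf_apply, Finsupp.neg_apply]; split_ifs <;> ring

/-- On a single lamp: `flipConf P (δ_x m) = δ_x (±m)`. [folklore] -/
theorem flipConf_single (P : Ray → Prop) (x : Ray) (m : ℤ) : flipConf P (Finsupp.single x m) = Finsupp.single x (if P x then -m else m) := by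
  ext r
  rw [flipConf_apply, Finsupp.single_apply, Finsupp.single_apply]
  by_cases hx : x = r
  · subst hx; simp
  · simp [hx]

/-! ### §2 The map on `Γ₂` -/

/-- Every lamp configuration occurring in `Γ₂`, flipped, still occurs in `Γ₂` (the lamp subgroup is generated by the positions). [folklore] -/
theorem inl_flipConf_mem (P : Ray → Prop) {m : ↥wreathZ} (hm : m ∈ lampsW) :
    (inl (Multiplicative.ofAdd (flipConf P (Multiplicative.toAdd ((m : LampGroup ℤ)).left))) : LampGroup ℤ) ∈ wreathZ := by
  have key : ∀ y ∈ Subgroup.closure {y : ↥wreathZ | ∃ h ∈ treesW, y = h * sW * h⁻¹},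
      (inl (Multiplicative.ofAdd (flipConf P (Multiplicative.toAdd ((y : LampGroup ℤ)).left))) : LampGroup ℤ) ∈ wreathZ := by
    intro y hy
    refine Subgroup.closure_induction (p := fun (y : ↥wreathZ) _ =>
      (inl (Multiplicative.ofAdd (flipConf P (Multiplicative.toAdd ((y : LampGroup ℤ)).left))) : LampGroup ℤ) ∈ wreathZ) ?_ ?_ ?_ ?_ hy
    · rintro _ ⟨t, ht, rfl⟩
      rw [coe_conj_sW_of_mem_treesW ht, lamp_left, toAdd_ofAdd, flipConf_single]
      have h := ((t * sW * t⁻¹) ^ (if P (((t : LampGroup ℤ)).right rho) then (-1 : ℤ) else 1)).2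
      rwa [Subgroup.coe_zpow, coe_conj_sW_of_mem_treesW ht, lamp_zpow] at h
    · rw [Subgroup.coe_one, one_left, toAdd_one, flipConf_zero, ofAdd_zero, map_one]; exact wreathZ.one_mem
    · intro x y hx hy ihx ihy
      have hxL : x ∈ lampsW := frameW.closure_positions_le hx
      rw [Subgroup.coe_mul, mul_left, mem_lampsW.1 hxL, map_one, MulAut.one_apply, toAdd_mul, flipConf_add, ofAdd_add, map_mul]
      exact wreathZ.mul_mem ihx ihy
    · intro x hx ihx
      have hxL : x ∈ lampsW := frameW.closure_positions_le hx
      rw [Subgroup.coe_inv, inv_left, mem_lampsW.1 hxL, inv_one, map_one, MulAut.one_apply, toAdd_inv, flipConf_neg, ofAdd_neg, map_inv]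
      exact wreathZ.inv_mem ihx
  exact key m (frameW.gen m hm)

/-- **Negate the lamps in `P`, keep the tree coordinate.** [cite: BartholdiErschler2012, §2] -/
def flipW (P : Ray → Prop) (v : ↥wreathZ) : ↥wreathZ :=
  ⟨inl (Multiplicative.ofAdd (flipConf P (Multiplicative.toAdd ((v : LampGroup ℤ)).left))) * inr ((v : LampGroup ℤ)).right,
    wreathZ.mul_mem (inl_flipConf_mem P (m := lamW v) (frameW.lam_mem v)) (inr_right_mem_wreathZ v.2)⟩

/-- The lamp configuration and tree coordinate of `flipW P v`. [folklore] -/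
theorem coe_flipW (P : Ray → Prop) (v : ↥wreathZ) :
    Multiplicative.toAdd (((flipW P v : ↥wreathZ)) : LampGroup ℤ).left = flipConf P (Multiplicative.toAdd ((v : LampGroup ℤ)).left) ∧
      (((flipW P v : ↥wreathZ)) : LampGroup ℤ).right = ((v : LampGroup ℤ)).right := by
  constructor
  · show Multiplicative.toAdd ((inl _ * inr _ : LampGroup ℤ)).left = _
    rw [mul_left, left_inl, right_inl, map_one, MulAut.one_apply, left_inr, mul_one, toAdd_ofAdd]
  · show ((inl _ * inr _ : LampGroup ℤ)).right = _
    rw [mul_right, right_inl, one_mul, right_inr]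

/-- `flipW P` is an involution. [folklore] -/
theorem flipW_flipW (P : Ray → Prop) (v : ↥wreathZ) : flipW P (flipW P v) = v := by
  refine Subtype.ext (SemidirectProduct.ext ?_ ?_)
  · apply Multiplicative.toAdd.injective
    rw [(coe_flipW P _).1, (coe_flipW P v).1, flipConf_flipConf]
  · rw [(coe_flipW P _).2, (coe_flipW P v).2]

/-- Right multiplication by a tree element commutes with `flipW`. [folklore] -/
theorem flipW_mul_of_left_eq_one (P : Ray → Prop) (v : ↥wreathZ) {t : ↥wreathZ} (ht : ((t : LampGroup ℤ)).left = 1) :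
    flipW P (v * t) = flipW P v * t := by
  refine Subtype.ext (SemidirectProduct.ext ?_ ?_)
  · apply Multiplicative.toAdd.injective
    rw [(coe_flipW P _).1, Subgroup.coe_mul, Subgroup.coe_mul, mul_left, mul_left, ht, map_one, mul_one, map_one, mul_one, (coe_flipW P v).1]
  · rw [(coe_flipW P _).2, Subgroup.coe_mul, Subgroup.coe_mul, mul_right, mul_right, (coe_flipW P v).2]

/-- Right multiplication by the lamp letter: `flipW P (v·s) = flipW P v · s^{∓1}` according to the pattern at the position `v.right ρ`. [folklore] -/
theorem flipW_mul_sW (P : Ray → Prop) (v : ↥wreathZ) :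
    flipW P (v * sW) = flipW P v * sW ^ (if P (((v : LampGroup ℤ)).right rho) then (-1 : ℤ) else 1) := by
  refine Subtype.ext (SemidirectProduct.ext ?_ ?_)
  · apply Multiplicative.toAdd.injective
    rw [(coe_flipW P _).1, Subgroup.coe_mul, Subgroup.coe_mul, Subgroup.coe_zpow, mul_left, mul_left, coe_sW, lamp_zpow, lamp_left, lamp_left,
      toAdd_mul, toAdd_mul, toAdd_lampAut_apply, toAdd_lampAut_apply, toAdd_ofAdd, toAdd_ofAdd, Finsupp.equivMapDomain_single,
      Finsupp.equivMapDomain_single, (coe_flipW P v).2, flipConf_add, (coe_flipW P v).1, flipConf_single]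
  · rw [(coe_flipW P _).2, Subgroup.coe_mul, Subgroup.coe_mul, Subgroup.coe_zpow, mul_right, mul_right, coe_sW, lamp_zpow, lamp_right, lamp_right,
      (coe_flipW P v).2]

/-- `flipW P` maps edges to edges. [folklore] -/
theorem cay_adj_flipW (P : Ray → Prop) {u w : ↥wreathZ} (h : Cay.Adj u w) : Cay.Adj (flipW P u) (flipW P w) := by
  have adj_s : ∀ u : ↥wreathZ, Cay.Adj (flipW P u) (flipW P (u * sW)) := fun u => by
    rw [flipW_mul_sW]
    split_ifs
    · rw [zpow_neg, zpow_one]; exact cay_adj_mul _ .si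
    · rw [zpow_one]; exact cay_adj_mul _ .s
  obtain ⟨y, rfl⟩ := cay_adj_iff.1 h
  cases y
  · rw [show L6.a.toW = aW from rfl, flipW_mul_of_left_eq_one P u rfl]; exact cay_adj_mul _ .a
  · rw [show L6.b.toW = bW from rfl, flipW_mul_of_left_eq_one P u rfl]; exact cay_adj_mul _ .b
  · rw [show L6.c.toW = cW from rfl, flipW_mul_of_left_eq_one P u rfl]; exact cay_adj_mul _ .c
  · rw [show L6.d.toW = dW from rfl, flipW_mul_of_left_eq_one P u rfl]; exact cay_adj_mul _ .d
  · exact adj_s u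
  · -- `w = u s⁻¹`: use the edge from `w` to `w s = u`
    have h' := adj_s (u * L6.si.toW)
    rw [show u * L6.si.toW * sW = u from inv_mul_cancel_right u sW] at h'
    exact h'.symm

/-- **THE SIGN-PATTERN AUTOMORPHISM** of `Cay(ℤ ≀_X 𝔊; a,b,c,d,s)`: negate the lamps in `P`. [cite: BartholdiErschler2012, §2] -/
def flipAut (P : Ray → Prop) : Cay ≃g Cay where
  toEquiv := Function.Involutive.toPerm (flipW P) (flipW_flipW P)
  map_rel_iff' := by
    intro u w
    refine ⟨fun h => ?_, cay_adj_flipW P⟩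
    have h' := cay_adj_flipW P h
    simp only [Function.Involutive.coe_toPerm, flipW_flipW] at h'
    exact h'

/-- `flipAut P v = flipW P v`. [folklore] -/
theorem flipAut_apply (P : Ray → Prop) (v : ↥wreathZ) : flipAut P v = flipW P v := rfl

/-- **The sign patterns fix the base vertex.** [folklore] -/
theorem flipAut_one (P : Ray → Prop) : flipAut P 1 = 1 := by
  rw [flipAut_apply]
  refine Subtype.ext (SemidirectProduct.ext ?_ ?_)
  · apply Multiplicative.toAdd.injective
    rw [(coe_flipW P _).1, Subgroup.coe_one, one_left, toAdd_one, flipConf_zero]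
  · rw [(coe_flipW P _).2, Subgroup.coe_one, one_right]

/-- The pattern `{x}` sends the lamp at `x` to its inverse: `flipAut {x} (t s t⁻¹) = (t s t⁻¹)⁻¹` when `t.right ρ = x`. [folklore] -/
theorem flipAut_singleton_conj {t : ↥wreathZ} (ht : t ∈ treesW) :
    flipAut (fun r => r = ((t : LampGroup ℤ)).right rho) (t * sW * t⁻¹) = (t * sW * t⁻¹)⁻¹ := by
  rw [flipAut_apply]
  refine Subtype.ext (SemidirectProduct.ext ?_ ?_)
  · apply Multiplicative.toAdd.injective
    rw [(coe_flipW _ _).1, Subgroup.coe_inv, coe_conj_sW_of_mem_treesW ht, lamp_inv, lamp_left, lamp_left, toAdd_ofAdd, toAdd_ofAdd,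
      flipConf_single, if_pos rfl]
  · rw [(coe_flipW _ _).2, Subgroup.coe_inv, coe_conj_sW_of_mem_treesW ht, lamp_inv, lamp_right, lamp_right]

/-- **THE VERTEX STABILISER OF `Cay(ℤ ≀_X 𝔊; a,b,c,d,s)` IS INFINITE**: the single-position patterns at the infinitely many orbit points `g·ρ` are pairwise
distinct automorphisms fixing `1` (so the finite-stabiliser hypothesis `{α | α 1 = 1}.Finite` of «AutDiscreteWall» FAILS here — caveat (α) is real).
[cite: BartholdiErschler2012, §2–§3.1] -/
theorem infinite_stabilizer_one : {α : Cay ≃g Cay | α 1 = 1}.Infinite := by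
  -- the orbit of `ρ` is infinite
  obtain ⟨r, hrinj, hr⟩ := exists_orbit_seq rho rho 0
  choose g hg hgr using fun m => (hr m).1
  -- the patterns at the points `r m`
  let θ : ℕ → Cay ≃g Cay := fun m => flipAut fun x => x = r m
  refine Set.infinite_of_injective_forall_mem (f := θ) (fun m m' h => hrinj ?_) fun m => flipAut_one _
  -- distinct points give distinct automorphisms: evaluate at the lamp `t_m s t_m⁻¹`
  by_contra hne
  have ht : (⟨tree (g m), tree_mem_wreathZ (hg m)⟩ : ↥wreathZ) ∈ treesW := mem_treesW.2 rfl
  have hx : (((⟨tree (g m), tree_mem_wreathZ (hg m)⟩ : ↥wreathZ) : LampGroup ℤ)).right rho = r m := by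
    show (tree (g m) : LampGroup ℤ).right rho = r m; rw [tree_right, hgr]
  have h1 : θ m (⟨tree (g m), tree_mem_wreathZ (hg m)⟩ * sW * (⟨tree (g m), tree_mem_wreathZ (hg m)⟩)⁻¹) =
      (⟨tree (g m), tree_mem_wreathZ (hg m)⟩ * sW * (⟨tree (g m), tree_mem_wreathZ (hg m)⟩)⁻¹)⁻¹ := by
    have := flipAut_singleton_conj ht; rwa [hx] at this
  have h2 : θ m' (⟨tree (g m), tree_mem_wreathZ (hg m)⟩ * sW * (⟨tree (g m), tree_mem_wreathZ (hg m)⟩)⁻¹) =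
      ⟨tree (g m), tree_mem_wreathZ (hg m)⟩ * sW * (⟨tree (g m), tree_mem_wreathZ (hg m)⟩)⁻¹ := by
    show flipW _ _ = _
    refine Subtype.ext (SemidirectProduct.ext ?_ ?_)
    · apply Multiplicative.toAdd.injective
      rw [(coe_flipW _ _).1, coe_conj_sW_of_mem_treesW ht, lamp_left, toAdd_ofAdd, flipConf_single, hx, if_neg hne]
    · rw [(coe_flipW _ _).2]
  have h3 : θ m = θ m' := h
  rw [h3, h2] at h1
  -- a position is not its own inverse
  have h4 := congrArg (fun π : ↥wreathZ => Multiplicative.toAdd ((π : LampGroup ℤ)).left (r m)) h1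
  simp only [Subgroup.coe_inv, coe_conj_sW_of_mem_treesW ht, lamp_inv, lamp_left, toAdd_ofAdd, hx, Finsupp.single_eq_same] at h4
  omega

/-! ### §4 The stabiliser is uncountable -/

/-- The sign pattern `P` inverts the lamp `t s t⁻¹` when its position `t·ρ` lies in `P` and fixes it otherwise. [folklore] -/
theorem flipAut_conj_sW (P : Ray → Prop) {t : ↥wreathZ} (ht : t ∈ treesW) :
    flipAut P (t * sW * t⁻¹) = if P (((t : LampGroup ℤ)).right rho) then (t * sW * t⁻¹)⁻¹ else t * sW * t⁻¹ := by
  rw [flipAut_apply]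
  by_cases hP : P (((t : LampGroup ℤ)).right rho)
  · rw [if_pos hP]
    refine Subtype.ext (SemidirectProduct.ext ?_ ?_)
    · apply Multiplicative.toAdd.injective
      rw [(coe_flipW _ _).1, Subgroup.coe_inv, coe_conj_sW_of_mem_treesW ht, lamp_inv, lamp_left, lamp_left, toAdd_ofAdd, toAdd_ofAdd,
        flipConf_single, if_pos hP]
    · rw [(coe_flipW _ _).2, Subgroup.coe_inv, coe_conj_sW_of_mem_treesW ht, lamp_inv, lamp_right, lamp_right]
  · rw [if_neg hP]
    refine Subtype.ext (SemidirectProduct.ext ?_ ?_)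
    · apply Multiplicative.toAdd.injective
      rw [(coe_flipW _ _).1, coe_conj_sW_of_mem_treesW ht, lamp_left, toAdd_ofAdd, flipConf_single, if_neg hP]
    · rw [(coe_flipW _ _).2]

/-- A lamp is not its own inverse. [folklore] -/
theorem conj_sW_ne_inv {t : ↥wreathZ} (ht : t ∈ treesW) : t * sW * t⁻¹ ≠ (t * sW * t⁻¹)⁻¹ := by
  intro h
  have h4 := congrArg (fun π : ↥wreathZ => Multiplicative.toAdd ((π : LampGroup ℤ)).left (((t : LampGroup ℤ)).right rho)) h
  simp only [Subgroup.coe_inv, coe_conj_sW_of_mem_treesW ht, lamp_inv, lamp_left, toAdd_ofAdd, Finsupp.single_eq_same] at h4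
  omega

/-- **THE VERTEX STABILISER OF `Cay(ℤ ≀_X 𝔊; a,b,c,d,s)` IS UNCOUNTABLE**: the sign patterns on the subsets of an infinite orbit sequence `(gₘ·ρ)ₘ` are pairwise distinct
automorphisms fixing `1` — an injection `Set ℕ ↪ {α | α 1 = 1}` — and `Set ℕ` is uncountable (Cantor). [cite: BartholdiErschler2012, §2–§3.1] -/
theorem not_countable_stabilizer_one : ¬ ({α : Cay ≃g Cay | α 1 = 1}).Countable := by
  intro hc
  haveI := hc.to_subtype
  obtain ⟨r, hrinj, hr⟩ := exists_orbit_seq rho rho 0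
  choose g hg hgr using fun m => (hr m).1
  let Φ : Set ℕ → {α : Cay ≃g Cay | α 1 = 1} := fun A => ⟨flipAut fun x => ∃ m ∈ A, x = r m, flipAut_one _⟩
  have hΦ : Function.Injective Φ := by
    intro A A' h
    have h' : (flipAut fun x => ∃ m ∈ A, x = r m) = flipAut fun x => ∃ m ∈ A', x = r m := congrArg Subtype.val h
    ext m
    have ht : (⟨tree (g m), tree_mem_wreathZ (hg m)⟩ : ↥wreathZ) ∈ treesW := mem_treesW.2 rfl
    have hx : (((⟨tree (g m), tree_mem_wreathZ (hg m)⟩ : ↥wreathZ) : LampGroup ℤ)).right rho = r m := by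
      show (tree (g m) : LampGroup ℤ).right rho = r m; rw [tree_right, hgr]
    have hiff : ∀ B : Set ℕ, (∃ m' ∈ B, r m = r m') ↔ m ∈ B := fun B => ⟨fun ⟨m', hm', e⟩ => hrinj e ▸ hm', fun hm => ⟨m, hm, rfl⟩⟩
    have e := congrArg (fun φ : Cay ≃g Cay => φ (⟨tree (g m), tree_mem_wreathZ (hg m)⟩ * sW * (⟨tree (g m), tree_mem_wreathZ (hg m)⟩)⁻¹)) h'
    simp only [flipAut_conj_sW _ ht, hx, hiff] at e
    have hne := conj_sW_ne_inv ht
    by_cases hA : m ∈ A <;> by_cases hA' : m ∈ A'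
    · exact iff_of_true hA hA'
    · rw [if_pos hA, if_neg hA'] at e; exact absurd e.symm hne
    · rw [if_neg hA, if_pos hA'] at e; exact absurd e hne
    · exact iff_of_false hA hA'
  have h1 := Cardinal.mk_le_aleph0_iff.2 hΦ.countable
  rw [Cardinal.mk_set, Cardinal.mk_nat] at h1
  exact lt_irrefl _ (h1.trans_lt (Cardinal.cantor Cardinal.aleph0))

end Grigorchuk

end Summit.CriticalPhenomena.PercolationContinuityZ3.Theorems.Transplant
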